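import Literature.MathematicalPhysics.QuantumFieldTheory.Balaban1983to89.B11Prop7AssemblyThresholds
import Literature.MathematicalPhysics.QuantumFieldTheory.Balaban1983to89.B11SectFAssembly
import Literature.MathematicalPhysics.QuantumFieldTheory.Balaban1983to89.B11Thm1TwoTier

/-!
# `Balaban1983to89.B11LeafKnitTwoTierFull` — T. Bałaban, *The variational problem and background fields in renormalization group method
# for lattice gauge theories*, Commun. Math. Phys. **102** (1985) 277–309, doi:10.1007/bf01229381 [Balaban1985Variational]: **the B11 leaf
# and the DAG node N07 over the REPAIRED scale tower from Propositions 2–6, 9 and the LOCATED LEAVES ONLY** — the repaired path (cell GAPS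
# G-B11-A1b: two-tier hypothesis (7″), covariant V₀; `B11Thm1TwoTier.TowerT`) in its most reduced form: Theorem 1, Propositions 7, 8 and the
# Sect. F conclusion DERIVED (Sect. A = the repaired induction `B11Thm1TwoTier.thm1TAt_allLevels`; Sects. B–E = Props 2, 5, 6 + bridge laws +
# THRESHOLDED existence steps `B11Prop7AssemblyThresholds`; Sect. F = `B11SectFAssembly.Leaves` BY NAME), the leaf knit AT B₃″ = κ₀B₃

statement-level bookkeeping over published theorems with citation tags; proofs = kernel composition of landed modules BY NAME; nothing here
is a claim about the Yang–Mills mass gap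

PDF held: `paper:balaban1985-cmp102-variational-background` (journal page = PDF page + 276).

CITATION HEADER (lean-in-tree rule 2026-08-18) / WHAT IS REPRODUCED.  Cell `pub-ymgap`, Track A node N07 = [B11] (`Dag.B11_main` = «b5 → b6 →
b7 → b8 → b9 → b11», own leaf `DagBinding.B11Leaf Z`), prover seat `pub-ymgap-dag-n07-a` (KNIT-BY-NAME), seventh module; the repaired-tower
analogue of `B11LeafKnitFull` and the reduced form of `B11LeafKnitTwoTier` (referee ref-C READ #10 conditions (d)(e)).  A NEW LEAF over
`B11Prop7AssemblyThresholds` (the seat's module 4), `B11SectFAssembly` (reader r08 gen 8), `B11Thm1TwoTier` (unit b2b-balaban-b11-g4); nothing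
there is modified; NO definition (theorems only; the bundle is a structure literal of `DagBinding.PrintedCarriers11`).
§1 `leavesF_mono_B₃`: the located leaves of Sect. F are MONOTONE in the constant B₃ (it enters only the right-hand sides ¼M·max{B₃ε₁, ½ε₀} + …
   of (165), p. 304) — so `Leaves` at the Sect.-F constant B₃ give `Leaves` at B₃″ = κ₀B₃ ≥ B₃, hence Prop 8 and Sect. F at BOTH constants
   (`prop8_sectF_towerT`).
§2 `prop7From14_towerT_thr`: pv12's leaf `Prop7From14 T.toTower B₃ C₁` from Props 2, 5, 6 with thresholded existence steps
   (`B11Prop7AssemblyThresholds.prop7From14_of_props_thr`); `prop7Printed_towerT_of_from14`: the printed background-free Proposition 7 AT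
   (B₃κ₀, C₁) from `Prop7From14` + the repaired induction (`thm1TAt_allLevels`, `background_of_thm1TAt`; a₀ ↦ min{a₀, B₃κ₀a₁″}, a′₁ ↦
   min{a′₁/κ₀, a₁″}) — the content of `B11LeafKnitTwoTier.prop7Printed_towerT_of_parts` with `Prop7From14` as the input.
§3 `b11Leaf_towerT_full`, `b11_main_towerT_full`: the B11 leaf of the repaired tower bundle AT B₃″ = κ₀B₃ and the node N07 at a run bound
   to it, from: Props 2, 5, 6 at (B₃, C₁) (the induction's Sects. B–E input), Props 2, 3, 4, 5, 6 at (B₃″, C₁) (the leaf's conjuncts — two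
   instances of the same B₃-generic typed statements, referee condition (e)), Prop 9; the located leaves `hbg14`, bridge laws, thresholded
   existence steps, `TowerT.ClassLaws`, `VarProblemA.LawsA`, the repaired Sect. A leaves `StepA11T`/`StepA13T`/`BaseK1T` (content:
   V0-REPAIR.md, GAPS G-B11-A1d/A2 — referee condition (d): to be PROVED on the tower of record), `B11SectFAssembly.Leaves` at B₃; and the
   printed constant relations B₀ ≤ 4B₁, B₃ ≥ 1, L³ ≤ C₁, C′₁ ≤ C₁, R₁M₁ ≥ 1.
**Prop 9: `B11Prop9Model.prop9Printed_model` (seat dag-n07-b) inhabits p9 on a model family conditional on its `Letters` ((189) = `maj189`,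
GAPS G-B11-G2); the Hölder leaf `holder136` at β₀ = 1 vs [6] (1.36) for β₀ < 1 (G-B11-F3); (166′) = 1/16 (G-B11-02).**
HONEST FRAMING: a count-neutral Track-A side landing (YM-PLAN §1); NOT a discharge of node N07 (the B11 group is FREE at NODE 00 Stages 1–3,
`Node00.IsWorldOfRecord₃`); one finite T⁴ programme at fixed ε; Bałaban AS PRINTED with page locators (the repair labelled as such);
nothing continuum / ℝ⁴ / OS / mass-gap / Clay.
-/

namespace Literature.MathematicalPhysics.QuantumFieldTheory.Balaban1983to89.B11LeafKnitTwoTierFull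

open Literature.MathematicalPhysics.QuantumFieldTheory.Balaban1983to89
open Literature.MathematicalPhysics.QuantumFieldTheory.Balaban1983to89.B11
open Literature.MathematicalPhysics.QuantumFieldTheory.Balaban1983to89.B11Thm1
open Literature.MathematicalPhysics.QuantumFieldTheory.Balaban1983to89.B11Thm1TwoTier
open Literature.MathematicalPhysics.QuantumFieldTheory.Balaban1983to89.DagBinding
open Literature.MathematicalPhysics.QuantumFieldTheory.Balaban1983to89.B11Prop7Assembly (Bridge)
open Literature.MathematicalPhysics.QuantumFieldTheory.Balaban1983to89.B11SectFAssembly (CubeData Leaves tinv)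
open Literature.MathematicalPhysics.QuantumFieldTheory.Balaban1983to89.B11Prop7AssemblyThresholds (prop7From14_of_props_thr)

variable {I : Type}

/-! ## §1. The Sect. F leaves are monotone in B₃; Prop 8 and Sect. F at both constants -/

/-- **The located leaves of Sect. F are monotone in B₃**: the constant B₃ of (162) enters `B11SectFAssembly.Leaves` only through the right-hand
sides «¼M_Δ max{B₃ε₁, ½ε₀} + …» of (165) (p. 304), which grow with B₃ (for ε₁ > 0, M_Δ ≥ R₁M₁ ≥ 0 and the positive scale unit (Lʲη)⁻¹).
Bookkeeping; used to read the leaves at B₃″ = κ₀B₃. [cite: Balaban1985Variational, (165) p.304] -/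
theorem leavesF_mono_B₃ {P : VarProblemX} {D : CubeData P} {d L B₁ B₂ B₃ B₃' K R₁M₁ c₁ a₃ a₄ : ℝ}
    (h : Leaves P D d L B₁ B₂ B₃ K R₁M₁ c₁ a₃ a₄) (hR : 0 ≤ R₁M₁) (hB : B₃ ≤ B₃') :
    Leaves P D d L B₁ B₂ B₃' K R₁M₁ c₁ a₃ a₄ := by
  have ht : ∀ c : P.Cube, 0 ≤ tinv P c := fun c => by
    unfold tinv
    have := h.L_pos
    have := h.eta_pos
    positivity
  have hm : ∀ ε₀ ε₁ : ℝ, 0 < ε₁ → max (B₃ * ε₁) (ε₀ / 2) ≤ max (B₃' * ε₁) (ε₀ / 2) := fun ε₀ ε₁ hε₁ =>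
    max_le_max (mul_le_mul_of_nonneg_right hB hε₁.le) le_rfl
  refine ⟨h.L_pos, h.eta_pos, h.size_ge, ?_, ?_, h.dev1142, h.inU_local, h.holder136⟩
  · intro ε₀ ε₁ V U c hε₁ hV hU hBV hcrit h1 h2 h3
    obtain ⟨hG, hA, hGr, hLap⟩ := h.reg165 ε₀ ε₁ V U c hε₁ hV hU hBV hcrit h1 h2 h3
    have hM : 0 ≤ P.sizeM c := hR.trans (h.size_ge c)
    have hM4 : 0 ≤ 1 / 4 * P.sizeM c := mul_nonneg (by norm_num) hM
    have hle : ∀ k : ℕ,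
        (1 / 4 * P.sizeM c * max (B₃ * ε₁) (ε₀ / 2) + K * (P.sizeM c / R₁M₁ * ε₀) ^ 2) * tinv P c ^ k ≤
          (1 / 4 * P.sizeM c * max (B₃' * ε₁) (ε₀ / 2) + K * (P.sizeM c / R₁M₁ * ε₀) ^ 2) * tinv P c ^ k := fun k =>
      mul_le_mul_of_nonneg_right (add_le_add (mul_le_mul_of_nonneg_left (hm ε₀ ε₁ hε₁) hM4) le_rfl)
        (pow_nonneg (ht c) k)
    exact ⟨hG, hA.trans_le (hle 1), hGr.trans_le (hle 2), hLap.trans_le (hle 3)⟩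
  · intro ε₀ ε₁ V U c hε₁ hV hU hBV hcrit h1 h2 h3
    obtain ⟨hA, hGr, hLap⟩ := h.reg165_unit ε₀ ε₁ V U c hε₁ hV hU hBV hcrit h1 h2 h3
    have hle : ∀ k : ℕ,
        (1 / 4 * max (B₃ * ε₁) (ε₀ / 2) + K * (P.sizeM c / R₁M₁ * ε₀) ^ 2) * tinv P c ^ k ≤
          (1 / 4 * max (B₃' * ε₁) (ε₀ / 2) + K * (P.sizeM c / R₁M₁ * ε₀) ^ 2) * tinv P c ^ k := fun k =>
      mul_le_mul_of_nonneg_right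
        (add_le_add (mul_le_mul_of_nonneg_left (hm ε₀ ε₁ hε₁) (by norm_num : (0 : ℝ) ≤ 1 / 4)) le_rfl)
        (pow_nonneg (ht c) k)
    exact ⟨hA.trans_le (hle 1), hGr.trans_le (hle 2), hLap.trans_le (hle 3)⟩

/-- **Prop 8 and Sect. F over the repaired tower at BOTH constants** B₃ and B₃″ = κ₀B₃ (κ₀ ≥ 1), from the Sect. F leaves at B₃ per level
member — `B11SectFAssembly.prop8Printed_of_leaves` / `sectFPrinted_of_leaves` BY NAME, at B₃ directly and at B₃κ₀ through `leavesF_mono_B₃`.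
[cite: Balaban1985Variational, Prop. 8 p.304, Sect. F (169) p.305] -/
theorem prop8_sectF_towerT (T : TowerT) (DF : ∀ p : Σ n, T.I n, CubeData (T.famAllX p)) {d B₁ B₂ B₃ K R₁M₁ c₁ a₃ a₄ : ℝ}
    (hLv : ∀ p, Leaves (T.famAllX p) (DF p) d T.L B₁ B₂ B₃ K R₁M₁ c₁ a₃ a₄) (lawsA : ∀ n i, (T.fam n i).LawsA) (hκ₀ : 1 ≤ T.κ₀)
    (hd : 1 ≤ d) (hL : 0 < T.L) (hB₁ : 0 < B₁) (hB₂ : 0 < B₂) (hB₃ : 0 < B₃) (hK : 0 < K) (hR : 1 ≤ R₁M₁) (hc₁ : 0 < c₁)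
    (ha₃ : 0 < a₃) (ha₄ : 0 < a₄) :
    (Prop8Printed B₃ T.famAllX ∧ SectFPrinted B₃ T.famAllX) ∧
      (Prop8Printed (B₃ * T.κ₀) T.famAllX ∧ SectFPrinted (B₃ * T.κ₀) T.famAllX) := by
  have mono : ∀ (p : Σ n, T.I n) (e e' : ℝ) (U : (T.famAllX p).Cfg), e ≤ e' → (T.famAllX p).InU e U → (T.famAllX p).InU e' U :=
    fun p => (lawsA p.1 p.2).1.1
  have hBκ : B₃ ≤ B₃ * T.κ₀ := by nlinarith
  have hBκpos : 0 < B₃ * T.κ₀ := by positivity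
  have hLv' : ∀ p, Leaves (T.famAllX p) (DF p) d T.L B₁ B₂ (B₃ * T.κ₀) K R₁M₁ c₁ a₃ a₄ :=
    fun p => leavesF_mono_B₃ (hLv p) (by linarith) hBκ
  exact ⟨⟨B11SectFAssembly.prop8Printed_of_leaves T.famAllX DF hLv hd hL hB₁ hB₃ hK (by linarith) hc₁ ha₃ ha₄ mono,
      B11SectFAssembly.sectFPrinted_of_leaves T.famAllX DF hLv (by linarith) hL hB₁ hB₂ hB₃ hK hR hc₁ ha₃ ha₄⟩,
    ⟨B11SectFAssembly.prop8Printed_of_leaves T.famAllX DF hLv' hd hL hB₁ hBκpos hK (by linarith) hc₁ ha₃ ha₄ mono,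
      B11SectFAssembly.sectFPrinted_of_leaves T.famAllX DF hLv' (by linarith) hL hB₁ hB₂ hBκpos hK hR hc₁ ha₃ ha₄⟩⟩

/-! ## §2. Proposition 7 over the repaired tower: from a background (thresholded), and the printed form at B₃″ -/

section Repaired

variable (T : TowerT) (famD : (Σ n, T.I n) → LGData) (β : ∀ p : Σ n, T.I n, Bridge (T.famAllX p) (famD p))
  (bg : ∀ p : Σ n, T.I n, (T.fam p.1 p.2).Cfg → (famD p).Cfg)

/-- **pv12's leaf `Prop7From14 T.toTower B₃ C₁` from Props 2, 5, 6 with THRESHOLDED existence steps** (background constant C₁, law `hbg14` =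
(14) p. 280 on both carriers) — `B11Prop7AssemblyThresholds.prop7From14_of_props_thr` once on the Σ-family.
[cite: Balaban1985Variational, Prop. 7 p.299; (14) p.280; (122) p.296] -/
theorem prop7From14_towerT_thr {B₀ B₁ B₃ C₁ c₁ O₁ O₂ e₅ c : ℝ}
    (hbg14 : ∀ (p : Σ n, T.I n) (ε : ℝ) (V : (T.fam p.1 p.2).Bdry) (U : (T.fam p.1 p.2).Cfg),
      (T.fam p.1 p.2).Sat14 C₁ B₃ ε V U → (famD p).Sat14 (C₁ * B₃ * ε) (C₁ * ε) ((β p).bdry V) (bg p U))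
    (laws : ∀ p, (β p).Laws C₁ B₃)
    (crit112 : ∀ (p : Σ n, T.I n) (ε₁ : ℝ) (V : (T.famAllX p).Bdry) (U₀ : (famD p).Cfg) (A₁ : (famD p).Fld), 0 < ε₁ → ε₁ ≤ c →
      (famD p).Sat14 (C₁ * B₃ * ε₁) (C₁ * ε₁) ((β p).bdry V) U₀ → (famD p).Sol111 ((β p).bdry V) U₀ A₁ →
      (famD p).nMax U₀ A₁ < 3 * B₀ * C₁ * B₃ * ε₁ →
        (famD p).CritL ((β p).bdry V) U₀ ((famD p).T112 ((β p).bdry V) U₀ A₁) ∧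
          (famD p).In19_21 (O₁ * C₁ * B₃ * ε₁) ((β p).bdry V) U₀ ((famD p).T112 ((β p).bdry V) U₀ A₁))
    (axial18 : ∀ (p : Σ n, T.I n) (ε₁ ε₂ : ℝ) (V : (T.famAllX p).Bdry) (U₀ : (famD p).Cfg) (U₁ : (famD p).Pert),
      0 < ε₁ → ε₁ ≤ c → 0 < ε₂ → ε₂ ≤ c →
      (famD p).Sat14 (C₁ * B₃ * ε₁) (C₁ * ε₁) ((β p).bdry V) U₀ → (famD p).In19_21 ε₂ ((β p).bdry V) U₀ U₁ →
      (famD p).CritL ((β p).bdry V) U₀ U₁ →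
        ∃ u : (famD p).GT, (famD p).Restricted U₀ u ∧ (T.famAllX p).InU (O₂ * ε₂) ((β p).emb U₀ ((famD p).toAxial U₀ U₁ u)) ∧
          (T.famAllX p).InB V ((β p).emb U₀ ((famD p).toAxial U₀ U₁ u)) ∧
          (T.famAllX p).IsCritical V ((β p).emb U₀ ((famD p).toAxial U₀ U₁ u)))
    (minimal142 : ∀ (p : Σ n, T.I n) (e ε₁ : ℝ) (V : (T.famAllX p).Bdry) (U₀ : (famD p).Cfg) (U₁ : (famD p).Pert) (u : (famD p).GT),
      e ≤ e₅ → 0 < ε₁ → ε₁ ≤ c →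
      (famD p).Sat14 (C₁ * B₃ * ε₁) (C₁ * ε₁) ((β p).bdry V) U₀ → (famD p).CritL ((β p).bdry V) U₀ U₁ →
      (famD p).Restricted U₀ u → (T.famAllX p).InU e ((β p).emb U₀ ((famD p).toAxial U₀ U₁ u)) →
      (T.famAllX p).InB V ((β p).emb U₀ ((famD p).toAxial U₀ U₁ u)) →
      (T.famAllX p).IsCritical V ((β p).emb U₀ ((famD p).toAxial U₀ U₁ u)) →
        (T.famAllX p).OnMinimalOrbit e V ((β p).emb U₀ ((famD p).toAxial U₀ U₁ u)))
    (hB₀ : 0 < B₀) (hB₁ : 0 < B₁) (hB₃ : 1 ≤ B₃) (hC₁ : 1 ≤ C₁) (hB₀B₁ : B₀ ≤ 4 * B₁) (hc₁ : 0 < c₁)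
    (hO₁ : 0 < O₁) (hO₂ : 0 < O₂) (he₅ : 0 < e₅) (hc : 0 < c)
    (p2 : Prop2Printed B₁ B₃ C₁ c₁ famD) (p5 : Prop5Printed B₁ B₃ C₁ famD) (p6 : Prop6Printed B₀ B₃ C₁ famD) :
    Prop7From14 T.toTower B₃ C₁ := by
  obtain ⟨a₀, a₁', O, ha₀, ha₁', hO, H⟩ :=
    prop7From14_of_props_thr β laws crit112 axial18 minimal142 hB₀ hB₁ hB₃ hC₁ hB₀B₁ hc₁ hO₁ hO₂ he₅ hc p2 p5 p6
  refine ⟨a₀, a₁', O, ha₀, ha₁', hO, fun n i ε₀ ε₁ hε₁ V hV U₀ h14 => ?_⟩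
  exact H ⟨n, i⟩ ε₀ ε₁ hε₁ V hV (bg ⟨n, i⟩ U₀) (hbg14 ⟨n, i⟩ ε₁ V U₀ h14)

/-- **The printed background-free Proposition 7 over the repaired tower AT (B₃κ₀, C₁) from `Prop7From14`** and the repaired induction's
background supply for ε₁ ≤ a₁″ at the parameter κ₀ε₁ (`B11Thm1TwoTier.thm1TAt_allLevels` + `background_of_thm1TAt`): constants
a₀ ↦ min{a₀, B₃κ₀a₁″}, a′₁ ↦ min{a′₁/κ₀, a₁″} (the content of `B11LeafKnitTwoTier.prop7Printed_towerT_of_parts` with `Prop7From14` displayed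
as the input; cell GAPS G-pv12-1). [cite: Balaban1985Variational, Prop. 7 p.299; (11)–(14) pp.279–280] -/
theorem prop7Printed_towerT_of_from14 {B₃ C₁ : ℝ} (h7 : Prop7From14 T.toTower B₃ C₁) (cl : T.ClassLaws)
    (lawsA : ∀ n i, (T.fam n i).LawsA) (hA11 : StepA11T T) (hA13 : StepA13T T) (hK1 : BaseK1T T B₃ C₁)
    (hB₃ : 0 < B₃) (hL : 1 ≤ T.L) (hC₁L : T.L ^ 3 ≤ C₁) (hC₁' : T.C₁' ≤ C₁)
    (p8 : Prop8Printed B₃ T.famAllX) (sF : SectFPrinted B₃ T.famAllX) :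
    Prop7Printed (B₃ * T.κ₀) C₁ T.famAllX := by
  obtain ⟨C, hCB, HT⟩ := thm1TAt_allLevels T B₃ C₁ hB₃ hL hC₁L hC₁' cl lawsA hA11 hA13 hK1 h7 p8 sF
  obtain ⟨a₀, a₁', O, ha₀, ha₁', hO, H⟩ := h7
  have hκ₀ : 1 ≤ T.κ₀ := cl.1
  have hReg7T := cl.2.2.1
  have hRegT7 := cl.2.2.2.1
  have hκ₀pos : 0 < T.κ₀ := lt_of_lt_of_le one_pos hκ₀
  have hCBpos : 0 < C.B₃ := by rw [hCB]; positivity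
  have hdiv : C.B₃ / T.κ₀ = B₃ := by rw [hCB]; field_simp
  have hK1' : BaseK1T T (C.B₃ / T.κ₀) C₁ := by rw [hdiv]; exact hK1
  have Hbg : ∀ (n : ℕ) (i : T.I n) (ε₁ : ℝ), 0 < ε₁ → ε₁ ≤ C.a₁ → ∀ V : (T.fam n i).Bdry, (T.fam n i).Reg7 ε₁ V →
      ∃ U₀ : (T.fam n i).Cfg, (T.fam n i).Sat14 C₁ B₃ (T.κ₀ * ε₁) V U₀ := by
    intro n i ε₁ hε₁ hε₁a V hV
    have h := background_of_thm1TAt T C C₁ lawsA cl hC₁L hC₁' hL hCBpos hA11 hA13 hK1' HT n i ε₁ hε₁ hε₁a V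
      (hReg7T n i ε₁ V hV)
    rwa [hdiv] at h
  have hBκ : 0 < B₃ * T.κ₀ := mul_pos hB₃ hκ₀pos
  refine ⟨min a₀ (B₃ * T.κ₀ * C.a₁), min (a₁' / T.κ₀) C.a₁, O, lt_min ha₀ (mul_pos hBκ C.a₁_pos),
    lt_min (div_pos ha₁' hκ₀pos) C.a₁_pos, hO, fun p ε₀ ε₁ hε₁ V hV => ⟨?_, ?_⟩⟩
  · intro hε₀ hB₃ε
    have hε₁a : ε₁ ≤ C.a₁ := by
      have h : B₃ * T.κ₀ * ε₁ ≤ B₃ * T.κ₀ * C.a₁ := hB₃ε.trans (hε₀.trans (min_le_right _ _))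
      exact le_of_mul_le_mul_left h hBκ
    obtain ⟨U₀, h14⟩ := Hbg p.1 p.2 ε₁ hε₁ hε₁a V hV
    have hκε : 0 < T.κ₀ * ε₁ := mul_pos hκ₀pos hε₁
    exact (H p.1 p.2 ε₀ (T.κ₀ * ε₁) hκε V (hRegT7 p.1 p.2 ε₁ V (hReg7T p.1 p.2 ε₁ V hV)) U₀ h14).1
      (hε₀.trans (min_le_left _ _)) (by nlinarith)
  · intro hε₁a
    have hε₁C : ε₁ ≤ C.a₁ := hε₁a.trans (min_le_right _ _)
    have hε₁κ : T.κ₀ * ε₁ ≤ a₁' := by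
      have := (le_div_iff₀ hκ₀pos).1 (hε₁a.trans (min_le_left _ _))
      linarith [mul_comm T.κ₀ ε₁]
    obtain ⟨U₀, h14⟩ := Hbg p.1 p.2 ε₁ hε₁ hε₁C V hV
    have hκε : 0 < T.κ₀ * ε₁ := mul_pos hκ₀pos hε₁
    obtain ⟨U, hU⟩ := (H p.1 p.2 ε₀ (T.κ₀ * ε₁) hκε V (hRegT7 p.1 p.2 ε₁ V (hReg7T p.1 p.2 ε₁ V hV)) U₀ h14).2 hε₁κ
    refine ⟨U, ?_⟩
    have e : O * C₁ * (B₃ * T.κ₀) * ε₁ = O * C₁ * B₃ * (T.κ₀ * ε₁) := by ring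
    rw [e]
    exact hU

/-! ## §3. The B11 leaf of the repaired tower bundle at B₃″ = κ₀B₃ from Props 2–6, 9 and the located leaves; the node N07 -/

/-- **THE B11 LEAF OF THE REPAIRED TOWER BUNDLE, AT B₃″ = κ₀B₃, FROM PROPS 2, 3, 4, 5, 6, 9 AND THE LOCATED LEAVES ONLY.**  Theorem 1 by the
repaired induction fed with Props 2, 5, 6 at B₃ (§2) and Prop 8 / Sect. F at B₃ from the Sect. F leaves (§1); Proposition 7 at B₃″ (§2);
Prop 8 / Sect. F at B₃″ from the same leaves by monotonicity (§1); the leaf's Props 2, 3, 4, 5, 6 at B₃″ (`q2 … q6`) and Prop 9 enter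
verbatim.  Nothing of the series is asserted. [cite: Balaban1985Variational, Thm 1 p.279, Props 2–9 pp.281–309; Sect. A pp.279–280; Sect. F pp.300–305] -/
theorem b11Leaf_towerT_full (famAn : (Σ n, T.I n) → AnData)
    {B₀ B₁ B₃ B₅ C₁ C₂ C₃ c₁ c1h c₄ δ₀ β₀ O₁ O₂ e₅ c d B₂ K R₁M₁ a₃ a₄ : ℝ}
    (hbg14 : ∀ (p : Σ n, T.I n) (ε : ℝ) (V : (T.fam p.1 p.2).Bdry) (U : (T.fam p.1 p.2).Cfg),
      (T.fam p.1 p.2).Sat14 C₁ B₃ ε V U → (famD p).Sat14 (C₁ * B₃ * ε) (C₁ * ε) ((β p).bdry V) (bg p U))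
    (laws : ∀ p, (β p).Laws C₁ B₃)
    (crit112 : ∀ (p : Σ n, T.I n) (ε₁ : ℝ) (V : (T.famAllX p).Bdry) (U₀ : (famD p).Cfg) (A₁ : (famD p).Fld), 0 < ε₁ → ε₁ ≤ c →
      (famD p).Sat14 (C₁ * B₃ * ε₁) (C₁ * ε₁) ((β p).bdry V) U₀ → (famD p).Sol111 ((β p).bdry V) U₀ A₁ →
      (famD p).nMax U₀ A₁ < 3 * B₀ * C₁ * B₃ * ε₁ →
        (famD p).CritL ((β p).bdry V) U₀ ((famD p).T112 ((β p).bdry V) U₀ A₁) ∧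
          (famD p).In19_21 (O₁ * C₁ * B₃ * ε₁) ((β p).bdry V) U₀ ((famD p).T112 ((β p).bdry V) U₀ A₁))
    (axial18 : ∀ (p : Σ n, T.I n) (ε₁ ε₂ : ℝ) (V : (T.famAllX p).Bdry) (U₀ : (famD p).Cfg) (U₁ : (famD p).Pert),
      0 < ε₁ → ε₁ ≤ c → 0 < ε₂ → ε₂ ≤ c →
      (famD p).Sat14 (C₁ * B₃ * ε₁) (C₁ * ε₁) ((β p).bdry V) U₀ → (famD p).In19_21 ε₂ ((β p).bdry V) U₀ U₁ →
      (famD p).CritL ((β p).bdry V) U₀ U₁ →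
        ∃ u : (famD p).GT, (famD p).Restricted U₀ u ∧ (T.famAllX p).InU (O₂ * ε₂) ((β p).emb U₀ ((famD p).toAxial U₀ U₁ u)) ∧
          (T.famAllX p).InB V ((β p).emb U₀ ((famD p).toAxial U₀ U₁ u)) ∧
          (T.famAllX p).IsCritical V ((β p).emb U₀ ((famD p).toAxial U₀ U₁ u)))
    (minimal142 : ∀ (p : Σ n, T.I n) (e ε₁ : ℝ) (V : (T.famAllX p).Bdry) (U₀ : (famD p).Cfg) (U₁ : (famD p).Pert) (u : (famD p).GT),
      e ≤ e₅ → 0 < ε₁ → ε₁ ≤ c →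
      (famD p).Sat14 (C₁ * B₃ * ε₁) (C₁ * ε₁) ((β p).bdry V) U₀ → (famD p).CritL ((β p).bdry V) U₀ U₁ →
      (famD p).Restricted U₀ u → (T.famAllX p).InU e ((β p).emb U₀ ((famD p).toAxial U₀ U₁ u)) →
      (T.famAllX p).InB V ((β p).emb U₀ ((famD p).toAxial U₀ U₁ u)) →
      (T.famAllX p).IsCritical V ((β p).emb U₀ ((famD p).toAxial U₀ U₁ u)) →
        (T.famAllX p).OnMinimalOrbit e V ((β p).emb U₀ ((famD p).toAxial U₀ U₁ u)))
    (cl : T.ClassLaws) (lawsA : ∀ n i, (T.fam n i).LawsA) (hA11 : StepA11T T) (hA13 : StepA13T T) (hK1 : BaseK1T T B₃ C₁)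
    (DF : ∀ p : Σ n, T.I n, CubeData (T.famAllX p)) (hLv : ∀ p, Leaves (T.famAllX p) (DF p) d T.L B₁ B₂ B₃ K R₁M₁ c₁ a₃ a₄)
    (hd : 1 ≤ d) (hB₂ : 0 < B₂) (hK : 0 < K) (hR : 1 ≤ R₁M₁) (ha₃ : 0 < a₃) (ha₄ : 0 < a₄)
    (hB₀ : 0 < B₀) (hB₁ : 0 < B₁) (hB₃ : 1 ≤ B₃) (hL : 1 ≤ T.L) (hC₁L : T.L ^ 3 ≤ C₁) (hC₁' : T.C₁' ≤ C₁)
    (hB₀B₁ : B₀ ≤ 4 * B₁) (hc₁ : 0 < c₁) (hO₁ : 0 < O₁) (hO₂ : 0 < O₂) (he₅ : 0 < e₅) (hc : 0 < c)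
    (p2 : Prop2Printed B₁ B₃ C₁ c₁ famD) (p5 : Prop5Printed B₁ B₃ C₁ famD) (p6 : Prop6Printed B₀ B₃ C₁ famD)
    (q2 : Prop2Printed B₁ (B₃ * T.κ₀) C₁ c₁ famD) (q3 : Prop3Printed C₁ (B₃ * T.κ₀) C₂ C₃ B₀ c1h c₄ δ₀ famD)
    (q4 : Prop4Printed C₁ (B₃ * T.κ₀) famD) (q5 : Prop5Printed B₁ (B₃ * T.κ₀) C₁ famD)
    (q6 : Prop6Printed B₀ (B₃ * T.κ₀) C₁ famD) (p9 : Prop9Printed B₅ C₁ β₀ δ₀ famAn) :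
    B11Leaf
      { I11 := (Σ n, T.I n), famV := T.famAll, famLG := famD, famX := T.famAllX, famAn := famAn, B₀ := B₀, B₁ := B₁,
        B₃ := B₃ * T.κ₀, B₅ := B₅, C₁ := C₁, C₂ := C₂, C₃ := C₃, c₁ := c₁, c1h := c1h, c₄ := c₄, δ₀ := δ₀, β₀ := β₀ } := by
  have hB₃pos : 0 < B₃ := lt_of_lt_of_le one_pos hB₃
  have hLpos : 0 < T.L := lt_of_lt_of_le one_pos hL
  have hC₁ : 1 ≤ C₁ := (one_le_pow₀ hL).trans hC₁L
  obtain ⟨⟨p8, sF⟩, ⟨q8, qF⟩⟩ :=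
    prop8_sectF_towerT T DF hLv lawsA cl.1 hd hLpos hB₁ hB₂ hB₃pos hK hR hc₁ ha₃ ha₄
  have h7 : Prop7From14 T.toTower B₃ C₁ :=
    prop7From14_towerT_thr T famD β bg hbg14 laws crit112 axial18 minimal142 hB₀ hB₁ hB₃ hC₁ hB₀B₁ hc₁ hO₁ hO₂ he₅ hc p2 p5 p6
  have t1 : Thm1Printed T.famAll :=
    thm1Printed_allLevels_twoTier T B₃ C₁ hB₃pos hL hC₁L hC₁' cl lawsA hA11 hA13 hK1 h7 p8 sF
  have p7 : Prop7Printed (B₃ * T.κ₀) C₁ T.famAllX :=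
    prop7Printed_towerT_of_from14 T h7 cl lawsA hA11 hA13 hK1 hB₃pos hL hC₁L hC₁' p8 sF
  exact ⟨t1, q2, q3, q4, q5, q6, p7, q8, qF, p9⟩

/-- **THE NODE N07 AT A RUN BOUND TO THE REPAIRED TOWER BUNDLE, FROM PROPS 2–6, 9 AND THE LOCATED LEAVES ONLY** (`b11Leaf_towerT_full` under
`w.up P = Upstream.ofPrintedAllXPN X Y ⟨bundle at B₃″ = κ₀B₃⟩ V W`).  The hypothesis list is the repaired path's pin list for N07 (referee
conditions (d)(e)); nothing is discharged (the B11 group is free at Stages 1–3). [cite: Balaban1985Variational, Thm 1 p.279, Props 2–9 pp.281–309] -/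
theorem b11_main_towerT_full (w : WorldP) (P : B12.RunParams) (X : PrintedCarriersR) (Y : PrintedCarriers9X)
    (V : PrintedCarriers14R) (W : PrintedCarriers15) (famAn : (Σ n, T.I n) → AnData)
    {B₀ B₁ B₃ B₅ C₁ C₂ C₃ c₁ c1h c₄ δ₀ β₀ O₁ O₂ e₅ c d B₂ K R₁M₁ a₃ a₄ : ℝ}
    (hP : w.up P = Upstream.ofPrintedAllXPN X Y
      { I11 := (Σ n, T.I n), famV := T.famAll, famLG := famD, famX := T.famAllX, famAn := famAn, B₀ := B₀, B₁ := B₁,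
        B₃ := B₃ * T.κ₀, B₅ := B₅, C₁ := C₁, C₂ := C₂, C₃ := C₃, c₁ := c₁, c1h := c1h, c₄ := c₄, δ₀ := δ₀, β₀ := β₀ } V W)
    (hbg14 : ∀ (p : Σ n, T.I n) (ε : ℝ) (V : (T.fam p.1 p.2).Bdry) (U : (T.fam p.1 p.2).Cfg),
      (T.fam p.1 p.2).Sat14 C₁ B₃ ε V U → (famD p).Sat14 (C₁ * B₃ * ε) (C₁ * ε) ((β p).bdry V) (bg p U))
    (laws : ∀ p, (β p).Laws C₁ B₃)
    (crit112 : ∀ (p : Σ n, T.I n) (ε₁ : ℝ) (V : (T.famAllX p).Bdry) (U₀ : (famD p).Cfg) (A₁ : (famD p).Fld), 0 < ε₁ → ε₁ ≤ c →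
      (famD p).Sat14 (C₁ * B₃ * ε₁) (C₁ * ε₁) ((β p).bdry V) U₀ → (famD p).Sol111 ((β p).bdry V) U₀ A₁ →
      (famD p).nMax U₀ A₁ < 3 * B₀ * C₁ * B₃ * ε₁ →
        (famD p).CritL ((β p).bdry V) U₀ ((famD p).T112 ((β p).bdry V) U₀ A₁) ∧
          (famD p).In19_21 (O₁ * C₁ * B₃ * ε₁) ((β p).bdry V) U₀ ((famD p).T112 ((β p).bdry V) U₀ A₁))
    (axial18 : ∀ (p : Σ n, T.I n) (ε₁ ε₂ : ℝ) (V : (T.famAllX p).Bdry) (U₀ : (famD p).Cfg) (U₁ : (famD p).Pert),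
      0 < ε₁ → ε₁ ≤ c → 0 < ε₂ → ε₂ ≤ c →
      (famD p).Sat14 (C₁ * B₃ * ε₁) (C₁ * ε₁) ((β p).bdry V) U₀ → (famD p).In19_21 ε₂ ((β p).bdry V) U₀ U₁ →
      (famD p).CritL ((β p).bdry V) U₀ U₁ →
        ∃ u : (famD p).GT, (famD p).Restricted U₀ u ∧ (T.famAllX p).InU (O₂ * ε₂) ((β p).emb U₀ ((famD p).toAxial U₀ U₁ u)) ∧
          (T.famAllX p).InB V ((β p).emb U₀ ((famD p).toAxial U₀ U₁ u)) ∧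
          (T.famAllX p).IsCritical V ((β p).emb U₀ ((famD p).toAxial U₀ U₁ u)))
    (minimal142 : ∀ (p : Σ n, T.I n) (e ε₁ : ℝ) (V : (T.famAllX p).Bdry) (U₀ : (famD p).Cfg) (U₁ : (famD p).Pert) (u : (famD p).GT),
      e ≤ e₅ → 0 < ε₁ → ε₁ ≤ c →
      (famD p).Sat14 (C₁ * B₃ * ε₁) (C₁ * ε₁) ((β p).bdry V) U₀ → (famD p).CritL ((β p).bdry V) U₀ U₁ →
      (famD p).Restricted U₀ u → (T.famAllX p).InU e ((β p).emb U₀ ((famD p).toAxial U₀ U₁ u)) →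
      (T.famAllX p).InB V ((β p).emb U₀ ((famD p).toAxial U₀ U₁ u)) →
      (T.famAllX p).IsCritical V ((β p).emb U₀ ((famD p).toAxial U₀ U₁ u)) →
        (T.famAllX p).OnMinimalOrbit e V ((β p).emb U₀ ((famD p).toAxial U₀ U₁ u)))
    (cl : T.ClassLaws) (lawsA : ∀ n i, (T.fam n i).LawsA) (hA11 : StepA11T T) (hA13 : StepA13T T) (hK1 : BaseK1T T B₃ C₁)
    (DF : ∀ p : Σ n, T.I n, CubeData (T.famAllX p)) (hLv : ∀ p, Leaves (T.famAllX p) (DF p) d T.L B₁ B₂ B₃ K R₁M₁ c₁ a₃ a₄)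
    (hd : 1 ≤ d) (hB₂ : 0 < B₂) (hK : 0 < K) (hR : 1 ≤ R₁M₁) (ha₃ : 0 < a₃) (ha₄ : 0 < a₄)
    (hB₀ : 0 < B₀) (hB₁ : 0 < B₁) (hB₃ : 1 ≤ B₃) (hL : 1 ≤ T.L) (hC₁L : T.L ^ 3 ≤ C₁) (hC₁' : T.C₁' ≤ C₁)
    (hB₀B₁ : B₀ ≤ 4 * B₁) (hc₁ : 0 < c₁) (hO₁ : 0 < O₁) (hO₂ : 0 < O₂) (he₅ : 0 < e₅) (hc : 0 < c)
    (p2 : Prop2Printed B₁ B₃ C₁ c₁ famD) (p5 : Prop5Printed B₁ B₃ C₁ famD) (p6 : Prop6Printed B₀ B₃ C₁ famD)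
    (q2 : Prop2Printed B₁ (B₃ * T.κ₀) C₁ c₁ famD) (q3 : Prop3Printed C₁ (B₃ * T.κ₀) C₂ C₃ B₀ c1h c₄ δ₀ famD)
    (q4 : Prop4Printed C₁ (B₃ * T.κ₀) famD) (q5 : Prop5Printed B₁ (B₃ * T.κ₀) C₁ famD)
    (q6 : Prop6Printed B₀ (B₃ * T.κ₀) C₁ famD) (p9 : Prop9Printed B₅ C₁ β₀ δ₀ famAn) :
    Dag.B11_main (leavesP w P) := by
  show (w.up P).b5 → (w.up P).b6 → (w.up P).b7 → (w.up P).b8 → (w.up P).b9 → (w.up P).b11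
  rw [hP]
  exact fun _ _ _ _ _ => b11Leaf_towerT_full T famD β bg famAn hbg14 laws crit112 axial18 minimal142 cl lawsA hA11 hA13 hK1 DF hLv
    hd hB₂ hK hR ha₃ ha₄ hB₀ hB₁ hB₃ hL hC₁L hC₁' hB₀B₁ hc₁ hO₁ hO₂ he₅ hc p2 p5 p6 q2 q3 q4 q5 q6 p9

end Repaired

end Literature.MathematicalPhysics.QuantumFieldTheory.Balaban1983to89.B11LeafKnitTwoTierFull
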